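import Summits.NavierStokesRegularity.NavierStokesRegularity.Theorems.ExtremiserTransienceNearExtremalTransienceExtremiserLiouvilleConstantSpeedCrossTermsAssembly
import Summits.NavierStokesRegularity.NavierStokesRegularity.Theorems.ExtremiserTransienceNearExtremalTransienceExtremiserLiouvilleConstantSpeedAxialCutoff
import Summits.NavierStokesRegularity.NavierStokesRegularity.Theorems.ExtremiserTransienceNearExtremalTransienceExtremiserLiouvilleConstantSpeedSlabEnergySandwich
import Summits.NavierStokesRegularity.NavierStokesRegularity.Theorems.ExtremiserTransienceNearExtremalTransienceExtremiserLiouvilleConstantSpeedJetGrowth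
import Literature.Analysis.FluidPDE.TaoEnstrophyLocalisationProofs
import HarnessLib

/-!
# Crux `ExtremiserTransience.NearExtremalTransience` (stmt-NavierStokesRegularity-21883), line `extremiser_liouville`,
# stub K1b — TOOLS FOR THE SLAB RATE: local gradient energy by local enstrophy, slab energies of the jet

`--supports stmt-NavierStokesRegularity-21883` (helper).  Author: prover seat `ns-el-k1b` (g7).  The far-field Caccioppoli
inequality (`…FarCaccioppoli`, `…CrossTermsAssembly.farCaccioppoli_weighted`) tested with the axial window cut-off
`θ_{R,ρ}(x) = g(R⁻¹x₂)χ_ρ(x)` (`…AxialCutoff`: `‖Dθ‖ ≤ K/R`, `‖D∇θ‖ ≤ K/R²`, supported in the slab `{R/4 ≤ x₂ ≤ 8R}`) and the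
slab energies of the jet (`∫_{R/4≤x₂≤8R}‖V‖² ≤ 10E₀R`, sandwich of g5):

* `integral_inner_gradient_fderiv_apply_eq` — `∫⟪∇θ, Dv V⟫ = −∫⟪(D∇θ)V, V⟫` (`V = v − c` divergence free, `θ ∈ C^∞_c`);
* `integral_mul_frobeniusNormSq_fderiv_le` — local gradient energy by local enstrophy: `∫θ|Dv|²_F ≤ ∫θ‖ω‖² + ∫‖D∇θ‖‖V‖²`;
* `integral_indicator_slab_sq_le` — `∫_{R/4 ≤ x₂ ≤ 8R}‖V‖² ≤ 10·R·E₀` for the jet (`R ≥ 1`);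
The slab rate itself (`slabRate_of_corrector_bound`) is in the companion file `…ConstantSpeedSlabRate`.

WHAT THIS IS NOT: K1b is NOT proved; nothing here proves NS regularity. [folklore]
-/

noncomputable section

open Set Filter Topology MeasureTheory Metric Function Real
open scoped ENNReal NNReal Topology InnerProductSpace RealInnerProductSpace ContDiff

namespace Summit.NavierStokesRegularity.NavierStokesRegularity.Theorems

-- the problem directory repeats the summit name (`NavierStokesRegularity/NavierStokesRegularity`)
set_option linter.dupNamespace false

namespace ExtremiserLiouville

open Literature.Analysis.FluidPDE Literature.Analysis
open DepletionLadder.KStar DepletionLadder.KStar.HalfSpace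

variable {v : E3 → E3} {c : E3} {θ : E3 → ℝ}

/-! ## 1. Two local identities -/

/-- **`∫⟪∇θ, Dv (v − c)⟫ = −∫⟪(D∇θ)(v − c), v − c⟫`** for `v ∈ C^∞` divergence free and `θ ∈ C^∞_c` (divergence theorem
for the `C¹_c` field `⟪∇θ, V⟫V`). [folklore] -/
theorem integral_inner_gradient_fderiv_apply_eq (hv : ContDiff ℝ ∞ v) (hdiv : VectorCalculus.IsDivFree v)
    (hθ : ContDiff ℝ ∞ θ) (hθc : HasCompactSupport θ) :
    (∫ x, ⟪gradient θ x, fderiv ℝ v x (v x - c)⟫) = -∫ x, ⟪fderiv ℝ (gradient θ) x (v x - c), v x - c⟫ := by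
  set V : E3 → E3 := fun y => v y - c with hVdef
  have hV : ContDiff ℝ ∞ V := hv.sub contDiff_const
  have hV1 : ContDiff ℝ 1 V := hV.of_le (by norm_cast)
  have hVd : Differentiable ℝ V := hV1.differentiable one_ne_zero
  have hDV : ∀ x, fderiv ℝ V x = fderiv ℝ v x := fun x => by simp only [hVdef]; rw [fderiv_sub_const]
  have hVdiv : VectorCalculus.IsDivFree V := isDivFree_sub_const hdiv c
  have hg : ContDiff ℝ ∞ (gradient θ) := contDiff_gradient_top hθ
  have hg1 : ContDiff ℝ 1 (gradient θ) := hg.of_le (by norm_cast)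
  have hgd : Differentiable ℝ (gradient θ) := hg1.differentiable one_ne_zero
  have hgc : HasCompactSupport (gradient θ) := hasCompactSupport_gradient hθc
  set g : E3 → ℝ := fun y => ⟪gradient θ y, V y⟫ with hgdef
  have hg1' : ContDiff ℝ 1 g := hg1.inner ℝ hV1
  have hgc' : HasCompactSupport g := by
    refine hgc.mono fun x hx => ?_
    simp only [hgdef, mem_support, ne_eq] at hx ⊢
    intro h0; exact hx (by rw [h0, inner_zero_left])
  have hY1 : ContDiff ℝ 1 (fun y => g y • V y) := hg1'.smul hV1
  have hYc : HasCompactSupport (fun y => g y • V y) := hgc'.smul_right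
  have h0 := integral_divergence_eq_zero hY1 hYc
  have hpt' : ∀ x, VectorCalculus.divergence (fun y => g y • V y) x =
      ⟪gradient θ x, fderiv ℝ v x (V x)⟫ + ⟪fderiv ℝ (gradient θ) x (V x), V x⟫ := by
    intro x
    rw [divergence_smul_apply (hg1'.differentiable one_ne_zero x) (hVd x), hVdiv x, mul_zero, zero_add,
      real_inner_comm, gradient, InnerProductSpace.toDual_symm_apply]
    show fderiv ℝ (fun y => ⟪gradient θ y, V y⟫) x (V x) = _
    rw [fderiv_inner_apply ℝ (hgd x) (hVd x), hDV]
  simp_rw [hpt'] at h0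
  have cV : Continuous V := hV.continuous
  have i1 : Integrable (fun x => ⟪gradient θ x, fderiv ℝ v x (V x)⟫) volume :=
    integrable_inner_of_hasCompactSupport_left hg.continuous ((hv.continuous_fderiv (by simp)).clm_apply cV) hgc
  have i2 : Integrable (fun x => ⟪fderiv ℝ (gradient θ) x (V x), V x⟫) volume := by
    refine integrable_inner_of_hasCompactSupport_left ((hg.continuous_fderiv (by simp)).clm_apply cV) cV ?_
    refine (hgc.fderiv (𝕜 := ℝ)).mono fun x hx => ?_
    simp only [mem_support, ne_eq] at hx ⊢
    intro h1; exact hx (by rw [h1, _root_.zero_apply])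
  rw [integral_add i1 i2] at h0
  linarith

/-- **Local gradient energy by local enstrophy**: for `v ∈ C^∞` divergence free and `θ ∈ C^∞_c`, `0 ≤ θ`:
`∫θ|Dv|²_F ≤ ∫θ‖ω‖² + ∫‖D∇θ‖·‖v − c‖²` (tree identity `∫θ|DV|²_F = ∫θ‖curl V‖² − ∫Dθ(DV V)` for `V = v − c` and
`integral_inner_gradient_fderiv_apply_eq`). [folklore] -/
theorem integral_mul_frobeniusNormSq_fderiv_le (hv : ContDiff ℝ ∞ v) (hdiv : VectorCalculus.IsDivFree v)
    (hθ : ContDiff ℝ ∞ θ) (hθc : HasCompactSupport θ) :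
    (∫ x, θ x * frobeniusNormSq (fderiv ℝ v x)) ≤
      (∫ x, θ x * ‖curl v x‖ ^ 2) + ∫ x, ‖fderiv ℝ (gradient θ) x‖ * ‖v x - c‖ ^ 2 := by
  set V : E3 → E3 := fun y => v y - c with hVdef
  have hV : ContDiff ℝ ∞ V := hv.sub contDiff_const
  have hV2 : ContDiff ℝ 2 V := hV.of_le (by norm_cast)
  have hDV : ∀ x, fderiv ℝ V x = fderiv ℝ v x := fun x => by simp only [hVdef]; rw [fderiv_sub_const]
  have hcurlV : curl V = curl v := curl_sub_const v c
  have hVdiv : VectorCalculus.IsDivFree V := isDivFree_sub_const hdiv c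
  have h := integral_mul_frobeniusNormSq_fderiv_eq hV2 hVdiv (hθ.of_le (by norm_cast)) hθc
  simp_rw [hDV, hcurlV] at h
  -- `∫ Dθ(Dv V) = ∫⟪∇θ, Dv V⟫ = −∫⟪(D∇θ)V, V⟫`
  have e1 : (∫ x, fderiv ℝ θ x (fderiv ℝ v x (V x))) = ∫ x, ⟪gradient θ x, fderiv ℝ v x (v x - c)⟫ := by
    refine integral_congr_ae (Eventually.of_forall fun x => ?_)
    show fderiv ℝ θ x (fderiv ℝ v x (V x)) = ⟪gradient θ x, fderiv ℝ v x (v x - c)⟫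
    rw [gradient, InnerProductSpace.toDual_symm_apply]
  rw [h, e1, integral_inner_gradient_fderiv_apply_eq hv hdiv hθ hθc]
  -- bound the remainder
  have cV : Continuous V := hV.continuous
  have hg : ContDiff ℝ ∞ (gradient θ) := contDiff_gradient_top hθ
  have cDg : Continuous (fderiv ℝ (gradient θ)) := hg.continuous_fderiv (by simp)
  have hDgc : HasCompactSupport (fderiv ℝ (gradient θ)) := (hasCompactSupport_gradient hθc).fderiv (𝕜 := ℝ)
  have iw : Integrable (fun x => ‖fderiv ℝ (gradient θ) x‖ * ‖v x - c‖ ^ 2) volume :=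
    (cDg.norm.mul (cV.norm.pow 2)).integrable_of_hasCompactSupport hDgc.norm.mul_right
  have hb : |∫ x, ⟪fderiv ℝ (gradient θ) x (v x - c), v x - c⟫| ≤ ∫ x, ‖fderiv ℝ (gradient θ) x‖ * ‖v x - c‖ ^ 2 := by
    rw [← Real.norm_eq_abs]
    refine norm_integral_le_of_norm_le iw (Eventually.of_forall fun x => ?_)
    rw [Real.norm_eq_abs]
    calc |⟪fderiv ℝ (gradient θ) x (v x - c), v x - c⟫| ≤ ‖fderiv ℝ (gradient θ) x (v x - c)‖ * ‖v x - c‖ :=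
          abs_real_inner_le_norm _ _
      _ ≤ (‖fderiv ℝ (gradient θ) x‖ * ‖v x - c‖) * ‖v x - c‖ := by gcongr; exact (fderiv ℝ (gradient θ) x).le_opNorm _
      _ = ‖fderiv ℝ (gradient θ) x‖ * ‖v x - c‖ ^ 2 := by ring
  have := le_abs_self (∫ x, ⟪fderiv ℝ (gradient θ) x (v x - c), v x - c⟫)
  linarith

/-! ## 2. Slab energies of the jet -/

/-- **`∫_{R/4 ≤ x₂ ≤ 8R}‖v − c‖² ≤ 10·R·E₀`** for the axial jet (`R ≥ 1`; slab-energy sandwich of g5). [folklore] -/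
theorem integral_indicator_slab_sq_le (hv : ContDiff ℝ ∞ v) (hdiv : VectorCalculus.IsDivFree v) {M : ℝ}
    (hM : ∀ x, ‖v x‖ = M) (hcM : ‖c‖ = M) (hc0 : c 0 = 0) (hc1 : c 1 = 0) (hc2 : c 2 ≠ 0)
    (hslab : ∀ T : ℝ, 0 < T → Integrable (fun x => {x : E3 | |x 2| ≤ T}.indicator (fun x => ‖v x - c‖ ^ 2) x) volume)
    {E₀ : ℝ} (hE0 : 0 ≤ E₀) (hE : ∀ s : ℝ, (∫ x, deriv Real.smoothTransition (x 2 - s) * ‖v x - c‖ ^ 2) = E₀)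
    {R : ℝ} (hR : 1 ≤ R) :
    (∫ x, {x : E3 | R / 4 ≤ x 2 ∧ x 2 ≤ 8 * R}.indicator (fun x => ‖v x - c‖ ^ 2) x) ≤ 10 * R * E₀ := by
  have hV1 : ContDiff ℝ 1 (fun y => v y - c) := (hv.sub contDiff_const).of_le (by norm_cast)
  have hVdiv : VectorCalculus.IsDivFree (fun y => v y - c) := isDivFree_sub_const hdiv c
  have hVc : ∀ x, ⟪(fun y => v y - c) x, c⟫ = -(‖(fun y => v y - c) x‖ ^ 2 / 2) := fun x =>
    inner_excess_eq_of_constSpeed hM hcM x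
  set N : ℕ := ⌈8 * R⌉₊ + 1 with hNdef
  set s : ℝ := R / 4 - 1 with hsdef
  have hN : 8 * R ≤ (⌈8 * R⌉₊ : ℝ) := Nat.le_ceil _
  have hN' : (N : ℝ) = (⌈8 * R⌉₊ : ℝ) + 1 := by rw [hNdef]; push_cast; ring
  have hNle : (N : ℝ) ≤ 10 * R := by
    have : (⌈8 * R⌉₊ : ℝ) < 8 * R + 1 := Nat.ceil_lt_add_one (by positivity)
    rw [hN']; linarith
  set T : ℝ := |s| + N + 2 with hTdef
  have hT0 : 0 < T := by rw [hTdef]; positivity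
  have hsand := (slabEnergy_sandwich_of_windowEnergy hV1 hVdiv hVc hc0 hc1 hc2 (le_refl T) (hslab T hT0)
    (E₀ := E₀) (fun u _ => hE u)).1
  -- monotonicity of the slabs: `[R/4, 8R] ⊆ [s+1, s+N]`
  have hsub : ∀ x : E3, {x : E3 | R / 4 ≤ x 2 ∧ x 2 ≤ 8 * R}.indicator (fun x => ‖v x - c‖ ^ 2) x ≤
      {x : E3 | s + 1 ≤ x 2 ∧ x 2 ≤ s + N}.indicator (fun x => ‖v x - c‖ ^ 2) x := by
    intro x
    by_cases hx : x ∈ {x : E3 | R / 4 ≤ x 2 ∧ x 2 ≤ 8 * R}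
    · have hx' : x ∈ {x : E3 | s + 1 ≤ x 2 ∧ x 2 ≤ s + N} := by
        refine ⟨by rw [hsdef]; linarith [hx.1], ?_⟩
        rw [hsdef, hN']; linarith [hx.2]
      rw [indicator_of_mem hx, indicator_of_mem hx']
    · rw [indicator_of_notMem hx]; exact indicator_nonneg (fun y _ => sq_nonneg _) _
  have hN0 : (0:ℝ) ≤ N := by positivity
  have hTa : -T ≤ s + 1 := by
    rw [hTdef]
    have := neg_abs_le s
    linarith
  have hTb : s + N ≤ T := by
    rw [hTdef]
    have := le_abs_self s
    linarith
  have hTa' : -T ≤ R / 4 := by rw [hsdef] at hTa; linarith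
  have hTb' : 8 * R ≤ T := by rw [hsdef, hN'] at hTb; linarith
  have i1 := integrable_indicator_slab_mul_sq (hv.sub contDiff_const).continuous hTa' hTb' (hslab T hT0)
  have i2 := integrable_indicator_slab_mul_sq (hv.sub contDiff_const).continuous hTa hTb (hslab T hT0)
  calc (∫ x, {x : E3 | R / 4 ≤ x 2 ∧ x 2 ≤ 8 * R}.indicator (fun x => ‖v x - c‖ ^ 2) x)
      ≤ ∫ x, {x : E3 | s + 1 ≤ x 2 ∧ x 2 ≤ s + N}.indicator (fun x => ‖v x - c‖ ^ 2) x := integral_mono i1 i2 hsub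
    _ ≤ N * E₀ := hsand
    _ ≤ 10 * R * E₀ := mul_le_mul_of_nonneg_right hNle hE0

end ExtremiserLiouville

end Summit.NavierStokesRegularity.NavierStokesRegularity.Theorems

end
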